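import Summits.ResolutionOfSingularities.ResolutionOfSingularities.Theorems.PurelyInseparableDim4JumpLedger
import Summits.ResolutionOfSingularities.ResolutionOfSingularities.Theorems.PurelyInseparableDim4MohAlongBound
import HarnessLib
import HarnessLib.Audit.Tags

/-!
# Purely inseparable four-folds `z^p + F(x₁,…,x₄)` — what a RISE of the shade costs, III:
# the jump ledger at points ALONG the centre [OURS · counted 0 · census brick PR-4′ of cell res-dim4-pi]

Sequel of `PurelyInseparableDim4KangarooLoss.lean` / `…JumpLedger.lean` (the ledger
`5·d + 2·NI + 2·|exc|` of census card I-2-1 at the points of the FIBRE OVER THE ORIGIN of an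
HP-permissible coordinate centre) and of `PurelyInseparableDim4MohAlong.lean` /
`…MohAlongBound.lean` (brick PR-1: the blow-up step at a point `b' + c` of the chart, `c` a point of
the centre, is the step at the fibre point `b'` of the state MOVED to `c` and re-cleaned,
`s@c = ⟨deletePthPowers p (translate c F), r|_{c=0}, exc|_{c=0}⟩` — written out as a structure
literal, as there).

* §1 (model level, any finite index type): the move along the centre never increases `NI` or
  `|exc|` (`card_filter_translate_le`, `card_exc_translate_le`) and keeps `supp r ⊆ exc`; hence, if
  the centre satisfies Hauser–Perlega's (1) ∧ (2) at the origin and the shade does NOT jump at `c`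
  (`shade(s@c) = shade(s)` — the constancy clause of `MohAlong.shade_step_le_shade_add_one_of_shade_translate_eq`;
  it cannot be dropped, `PurelyInseparableDim4MohAlongSpecialPoint.lean`; it is decided by the
  `S`-face criterion of `PurelyInseparableDim4MohAlongFace.lean`), then (2) holds at `c`, a RISE of the
  shade at `b' + c` is a rise for `s@c`, and part I's ledger for `s@c` gives the ledger RELATIVE TO
  THE ORIGIN STATE `s`: `5d′ + 2NI′ + 2|exc′| + 1 ≤ 5d + 2NI + 2|exc|`
  (`ledger_of_shadeIncreases_add`); the newborn multiplicity is `≡ 0 (mod p)` there too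
  (`dvd_step_r_self_of_shadeIncreases_add`). [cite: HauserPerlega2019PRIMS, §3 Theorem (6), (9),
  Comments (b), (d)] [cite: Moh1987, Stability Theorem (p. 966)]
* §2 (class `(4,1)`, the cell's frame): on every `Edge p S s s'` along a centre with
  `IsPermissibleCentre` ∧ `Perm2` at `s` on which the shade is constant at the `K`-points,
  RISE:d ⇒ `5·shade′ + 2·NI′ + 2·|exc′| < 5·shade + 2·NI + 2·|exc|` in ℕ∞
  (`ledger_lt_of_edge_of_riseD_of_shade_constant` — the companion of p-1's
  `MohAlong.shade_le_add_one_of_edge`), and the pointwise form at an arbitrary chart point `b` with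
  the no-jump clause only at `c = S.piecewise 0 b` (`ledger_lt_of_riseD_piecewise`).

HONEST SCOPE.  At the SPECIAL points of the centre (shade jump at `c`, (2) fails at `c`) nothing is
claimed — Hauser–Perlega's theorem does not apply there and the edge belongs to the census's
PERM2-0-at-`c` population; `e = 1` only; census value, not a statement about resolution of
singularities.  Resolution of singularities in dimension ≥ 4 / characteristic `p` is NOT proved
anywhere in this programme; counted 0; AI formalisation, weaker than expert review.

bears_on: LADDER-RESOLUTION:D157-DOOR2 (res-dim4-pi · PR-4′ III). Supports stmt-ResolutionOfSingularities-16155 (helper).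
-/

set_option linter.dupNamespace false

noncomputable section

open MvPolynomial Finset

open scoped BigOperators

namespace Summit.ResolutionOfSingularities.ResolutionOfSingularities.Theorems.PIDim4.JumpLedger

open Literature.AlgebraicGeometry.Resolution
open Literature.AlgebraicGeometry.Resolution.Hauser2010
open Literature.AlgebraicGeometry.Resolution.CentreBlowup
open KangarooLoss MohAlong

/-! ## 1. Model level: the move along the centre and the ledger at `b' + c` -/

section Along

variable {σ : Type*} {K : Type*} [Field K] [Fintype σ] [DecidableEq σ] [DecidableEq K]
variable (p : ℕ) [hp : Fact p.Prime] [CharP K p]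

omit [Fintype σ] [DecidableEq σ] hp [CharP K p] in
/-- Moving along the centre never creates a component with `p ∤ r_i`: `NI(s@c) ≤ NI(s)`. [folklore] -/
theorem card_filter_translate_le (c : σ → K) (r : σ →₀ ℕ) (exc : Finset σ) :
    ((exc.filter fun i => c i = 0).filter fun i => ¬ p ∣ (r.filter fun i => c i = 0) i).card ≤
      (exc.filter fun i => ¬ p ∣ r i).card := by
  refine Finset.card_le_card fun i hi => ?_
  rw [Finset.mem_filter, Finset.mem_filter] at hi
  obtain ⟨⟨hexc, hci⟩, hndvd⟩ := hi
  rw [Finsupp.filter_apply, if_pos hci] at hndvd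
  exact Finset.mem_filter.mpr ⟨hexc, hndvd⟩

omit [Fintype σ] [DecidableEq σ] hp [CharP K p] in
/-- Moving along the centre never creates an exceptional component: `|exc(s@c)| ≤ |exc(s)|`. [folklore] -/
theorem card_exc_translate_le (c : σ → K) (exc : Finset σ) :
    (exc.filter fun i => c i = 0).card ≤ exc.card :=
  Finset.card_filter_le _ _

omit [Fintype σ] [DecidableEq σ] hp [CharP K p] in
/-- `supp r ⊆ exc` survives the move along the centre. [folklore] -/
theorem mem_filter_exc_of_filter_r_ne_zero (c : σ → K) {r : σ →₀ ℕ} {exc : Finset σ}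
    (hexc : ∀ i, r i ≠ 0 → i ∈ exc) :
    ∀ i, (r.filter fun i => c i = 0) i ≠ 0 → i ∈ exc.filter fun i => c i = 0 := by
  intro i hi
  rw [Finsupp.filter_apply] at hi
  by_cases hci : c i = 0
  · rw [if_pos hci] at hi
    exact Finset.mem_filter.mpr ⟨hexc i hi, hci⟩
  · rw [if_neg hci] at hi
    exact (hi rfl).elim

omit hp [CharP K p] in
/-- **What the moved state inherits** (order of record `q = p`): for a clean state `s = (F, r, exc)`
with `F ≠ 0`, `y^r ∣ F`, a centre `C_S` with (1) on the support and (2) at the origin in `Perm2`-form,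
and a point `c` of the centre at which the shade does not jump, the moved-and-re-cleaned state
`s@c` is clean, with `y^{r|_{c=0}} ∣`, satisfies (1), and satisfies (2) in the per-monomial
form of `CentreBlowupMohStability.lean` for its own order. [folklore] -/
theorem translate_hypotheses {S : Finset σ} (c : σ → K) (hc : ∀ i ∈ S, c i = 0) (s : CState σ K)
    (hclean : deletePthPowers p s.F = s.F) (hr : ∀ d ∈ s.F.support, s.r ≤ d)
    (hq : ∀ d ∈ s.F.support, p ≤ degIn S d)
    (hperm : ((degIn S s.r : ℕ) : ℕ∞) + s.shade ≤ ordAlong S s.F)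
    (heq : CState.shade ⟨deletePthPowers p (PointBlowup.translate c s.F),
        s.r.filter (fun i => c i = 0), s.exc.filter (fun i => c i = 0)⟩ = s.shade)
    {oM : ℕ} (hoM : ordZero (deletePthPowers p (PointBlowup.translate c s.F)) = oM) :
    deletePthPowers p (deletePthPowers p (PointBlowup.translate c s.F)) =
        deletePthPowers p (PointBlowup.translate c s.F) ∧
      (∀ e ∈ (deletePthPowers p (PointBlowup.translate c s.F)).support,
        s.r.filter (fun i => c i = 0) ≤ e) ∧
      (∀ e ∈ (deletePthPowers p (PointBlowup.translate c s.F)).support, p ≤ degIn S e) ∧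
      (∀ e ∈ (deletePthPowers p (PointBlowup.translate c s.F)).support,
        degIn S (s.r.filter (fun i => c i = 0)) +
          (oM - (s.r.filter (fun i => c i = 0)).degree) ≤ degIn S e) := by
  set M : CState σ K := ⟨deletePthPowers p (PointBlowup.translate c s.F),
    s.r.filter (fun i => c i = 0), s.exc.filter (fun i => c i = 0)⟩ with hM
  refine ⟨PointBlowup.deletePthPowers_deletePthPowers p _,
    fun e he => filter_le_of_mem_support_clean_translate p c hr he,
    fun e he => le_degIn_of_mem_support_clean_translate p c hc hq he, ?_⟩
  have hpermc : ((degIn S M.r : ℕ) : ℕ∞) + M.shade ≤ ordAlong S M.F := by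
    show ((degIn S (s.r.filter (fun i => c i = 0)) : ℕ) : ℕ∞) + _ ≤
      ordAlong S (deletePthPowers p (PointBlowup.translate c s.F))
    rw [heq, degIn_filter_eq c hc, ordAlong_deletePthPowers_translate p c hc hclean]
    exact hperm
  exact perm_of_shade_le_ordAlong M hoM hpermc

/-- **Comment (b) at a point ALONG the centre** (`e = 1`): under (1) ∧ (2) at the origin and no
shade jump at `c`, an increase of the shade at the point `b' + c` of the `y_j`-chart forces
`p ∣ r′_j`. [cite: HauserPerlega2019PRIMS, §3 Comment (b)] -/
theorem dvd_step_r_self_of_shadeIncreases_add {S : Finset σ} {j : σ} (hj : j ∈ S) (b' c : σ → K)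
    (hb'j : b' j = 0) (hb' : ∀ i, i ∉ S → b' i = 0) (hc : ∀ i ∈ S, c i = 0) (s : CState σ K)
    (hclean : deletePthPowers p s.F = s.F) (hF : s.F ≠ 0) (hr : ∀ d ∈ s.F.support, s.r ≤ d)
    (hq : ∀ d ∈ s.F.support, p ≤ degIn S d)
    (hperm : ((degIn S s.r : ℕ) : ℕ∞) + s.shade ≤ ordAlong S s.F)
    (heq : CState.shade ⟨deletePthPowers p (PointBlowup.translate c s.F),
        s.r.filter (fun i => c i = 0), s.exc.filter (fun i => c i = 0)⟩ = s.shade)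
    (hinc : s.shade < (step p S j (b' + c) s).shade) : p ∣ (step p S j (b' + c) s).r j := by
  obtain ⟨oM, hoM⟩ := exists_ordZero_eq_natCast (clean_translate_ne_zero p c hclean hF)
  obtain ⟨-, hrM, hqM, hpermM⟩ := translate_hypotheses p c hc s hclean hr hq hperm heq hoM
  rw [step_add_eq_step_translate_clean_one p hj b' c hb' hc s hclean] at hinc ⊢
  set M : CState σ K := ⟨deletePthPowers p (PointBlowup.translate c s.F),
    s.r.filter (fun i => c i = 0), s.exc.filter (fun i => c i = 0)⟩ with hM
  have hincM : ShadeIncreases p S j b' M := by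
    unfold ShadeIncreases
    rw [heq]
    exact hinc
  exact dvd_step_r_self_of_shadeIncreases p hj b' hb'j hb' M hoM hrM hqM hpermM hincM

/-- **(A) at a point ALONG the centre** (`e = 1`, the composition of part I with brick PR-1): for a
clean state `s = (F, r, exc)` with `F ≠ 0`, `y^r ∣ F`, `supp r ⊆ exc`, a centre `C_S ∋ j` with
(1) on the support and (2) at the origin, a fibre coordinate `b'` (`b'_j = 0`, `b' = 0` off `S`) and a
point `c` of the centre (`c = 0` on `S`) at which the shade does NOT jump (`shade(s@c) = shade(s)`):
if the shade increases at `b' + c`, then — with `o`, `o′` the orders of `F` and of the new `F′` —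
`5(o′ − |r′|) + 2NI′ + 2|exc′| + 1 ≤ 5(o − |r|) + 2NI + 2|exc|`.  (Part I's `ledger_of_shadeIncreases`
for `s@c` at the fibre point `b'`, and `Φ¹(s@c) ≤ Φ¹(s)`.)
[cite: HauserPerlega2019PRIMS, §3 Theorem (6), (9), Comments (b), (d)] [cite: Moh1987, Stability Theorem (p. 966)] -/
theorem ledger_of_shadeIncreases_add {S : Finset σ} {j : σ} (hj : j ∈ S) (b' c : σ → K)
    (hb'j : b' j = 0) (hb' : ∀ i, i ∉ S → b' i = 0) (hc : ∀ i ∈ S, c i = 0) (s : CState σ K)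
    (hclean : deletePthPowers p s.F = s.F) {o o' : ℕ} (ho : ordZero s.F = o)
    (ho' : ordZero (step p S j (b' + c) s).F = o') (hr : ∀ d ∈ s.F.support, s.r ≤ d)
    (hexc : ∀ i, s.r i ≠ 0 → i ∈ s.exc) (hq : ∀ d ∈ s.F.support, p ≤ degIn S d)
    (hperm : ((degIn S s.r : ℕ) : ℕ∞) + s.shade ≤ ordAlong S s.F)
    (heq : CState.shade ⟨deletePthPowers p (PointBlowup.translate c s.F),
        s.r.filter (fun i => c i = 0), s.exc.filter (fun i => c i = 0)⟩ = s.shade)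
    (hinc : s.shade < (step p S j (b' + c) s).shade) :
    5 * (o' - (step p S j (b' + c) s).r.degree) +
        2 * ((step p S j (b' + c) s).exc.filter
          fun i => ¬ p ∣ (step p S j (b' + c) s).r i).card +
        2 * (step p S j (b' + c) s).exc.card + 1 ≤
      5 * (o - s.r.degree) + 2 * (s.exc.filter fun i => ¬ p ∣ s.r i).card + 2 * s.exc.card := by
  have hF : s.F ≠ 0 := ne_zero_of_ordZero_eq_natCast ho
  obtain ⟨oM, hoM⟩ := exists_ordZero_eq_natCast (clean_translate_ne_zero p c hclean hF)
  obtain ⟨hcleanM, hrM, hqM, hpermM⟩ := translate_hypotheses p c hc s hclean hr hq hperm heq hoM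
  have hexcM := mem_filter_exc_of_filter_r_ne_zero c (r := s.r) (exc := s.exc) hexc
  have hstep := step_add_eq_step_translate_clean_one p hj b' c hb' hc s hclean
  rw [hstep] at hinc ho' ⊢
  set M : CState σ K := ⟨deletePthPowers p (PointBlowup.translate c s.F),
    s.r.filter (fun i => c i = 0), s.exc.filter (fun i => c i = 0)⟩ with hM
  have hincM : ShadeIncreases p S j b' M := by
    unfold ShadeIncreases
    rw [heq]
    exact hinc
  have hL := ledger_of_shadeIncreases p hj b' hb'j hb' M hcleanM hoM ho' hrM hexcM hqM hpermM hincM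
  -- compare the moved state with the origin state: same shade, `NI` and `|exc|` do not grow
  have hNI := card_filter_translate_le p c s.r s.exc
  have hE := card_exc_translate_le c s.exc
  have hsh : oM - M.r.degree = o - s.r.degree := by
    have h := heq
    rw [CState.shade_eq_of_ordZero_eq M hoM, CState.shade_eq_of_ordZero_eq s ho] at h
    exact_mod_cast h
  have hNI' : (M.exc.filter fun i => ¬ p ∣ M.r i).card ≤ (s.exc.filter fun i => ¬ p ∣ s.r i).card :=
    hNI
  have hE' : M.exc.card ≤ s.exc.card := hE
  omega

end Along

/-! ## 2. Class `(4,1)`: the cell's frame (`IsPermissibleCentre`, `Perm2`, `RiseD`, `Edge`) -/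

section Frame

variable {K : Type} [Field K] [DecidableEq K] (p : ℕ) [hp : Fact p.Prime] [CharP K p]

/-- **(A) at an arbitrary chart point, pointwise form.** Class `(4,1)`, `e = 1`: for a clean
presented state `s` (`F ≠ 0`, `x^r ∣ F`, `supp r ⊆ exc`), a centre `S ∋ j` with `IsPermissibleCentre`
and `Perm2` at `s`, and ANY point `b` of the `x_j`-chart (`b_j = 0`) such that the shade does not jump
at its centre part `c = S.piecewise 0 b`: RISE:d ⇒
`5·shade′ + 2·NI′ + 2·|exc′| < 5·shade + 2·NI + 2·|exc|`.
[cite: HauserPerlega2019PRIMS, §3 Theorem (6), (9), Comments (b), (d)] -/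
theorem ledger_lt_of_riseD_piecewise {S : Finset (Fin 4)} {j : Fin 4} (hj : j ∈ S) (b : Fin 4 → K)
    (hbj : b j = 0) (s : State K) (hclean : deletePthPowers p s.F = s.F) (hF : s.F ≠ 0)
    (h1 : IsPermissibleCentre p S s.F) (h2 : Perm2 S s) (hr : ∀ d ∈ s.F.support, s.r ≤ d)
    (hexc : ∀ i, s.r i ≠ 0 → i ∈ s.exc)
    (heq : CState.shade ⟨deletePthPowers p (PointBlowup.translate (S.piecewise (0 : Fin 4 → K) b) s.F),
        s.r.filter (fun i => S.piecewise (0 : Fin 4 → K) b i = 0),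
        s.exc.filter (fun i => S.piecewise (0 : Fin 4 → K) b i = 0)⟩ = s.shade)
    (hrise : RiseD s (CentreBlowup.step p S j b s)) :
    5 * (CentreBlowup.step p S j b s).shade +
        2 * (((CentreBlowup.step p S j b s).exc.filter
          fun i => ¬ p ∣ (CentreBlowup.step p S j b s).r i).card : ℕ∞) +
        2 * ((CentreBlowup.step p S j b s).exc.card : ℕ∞) <
      5 * s.shade + 2 * ((s.exc.filter fun i => ¬ p ∣ s.r i).card : ℕ∞) +
        2 * (s.exc.card : ℕ∞) := by
  obtain ⟨o, ho⟩ := exists_ordZero_eq_natCast hF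
  have hq := (isPermissibleCentre_iff.mp h1).2
  have hc0 : ∀ i ∈ S, S.piecewise (0 : Fin 4 → K) b i = 0 := fun i hi => by
    rw [Finset.piecewise, if_pos hi, Pi.zero_apply]
  have hb'j : S.piecewise b (0 : Fin 4 → K) j = 0 := by rw [Finset.piecewise, if_pos hj, hbj]
  have hb' : ∀ i, i ∉ S → S.piecewise b (0 : Fin 4 → K) i = 0 := fun i hi => by
    rw [Finset.piecewise, if_neg hi, Pi.zero_apply]
  rw [← piecewise_add_piecewise S b] at hrise ⊢
  -- the new residual polynomial is non-zero (the new shade is finite since it exceeds a finite one? no: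
  -- it is bounded by Moh; use the moved state's non-vanishing instead)
  have hF' : (CentreBlowup.step p S j (S.piecewise b 0 + S.piecewise 0 b) s).F ≠ 0 := by
    rw [step_add_eq_step_translate_clean_one p hj _ _ hb' hc0 s hclean]
    have hMF := clean_translate_ne_zero p (S.piecewise (0 : Fin 4 → K) b) hclean hF
    obtain ⟨oM, hoM⟩ := exists_ordZero_eq_natCast hMF
    obtain ⟨hcleanM, hrM, hqM, -⟩ :=
      translate_hypotheses p _ hc0 s hclean hr hq h2 heq hoM
    exact step_F_ne_zero p hj _ hb'j hb' _ hcleanM hoM hrM hqM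
  obtain ⟨o', ho'⟩ := exists_ordZero_eq_natCast hF'
  have h := ledger_of_shadeIncreases_add p hj _ _ hb'j hb' hc0 s hclean ho ho' hr hexc hq h2 heq hrise
  rw [CState.shade_eq_of_ordZero_eq _ ho, CState.shade_eq_of_ordZero_eq _ ho']
  exact_mod_cast Nat.lt_of_succ_le h

/-- **(A) on every edge along a centre on which the shade is constant** — the companion of
`MohAlong.shade_le_add_one_of_edge`.  Class `(4,1)`, `e = 1`: let `s` be a clean presented state
(`F ≠ 0`, `x^r ∣ F`, `supp r ⊆ exc`) and `S` a coordinate centre with (1) `IsPermissibleCentre p S s.F`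
and (2) `Perm2 S s` at the origin, such that the shade of the state moved to any `K`-point `c` of the
centre equals `shade(s)`.  Then on every `Edge p S s s'` (any chart `j ∈ S`, any point `b`, `b_j = 0`)
with RISE:d: `5·shade(s') + 2·NI(s') + 2·|exc(s')| < 5·shade(s) + 2·NI(s) + 2·|exc(s)|`.  The
constancy clause cannot be dropped (`PurelyInseparableDim4MohAlongSpecialPoint.lean`).
[cite: HauserPerlega2019PRIMS, §3 Theorem (6), (9), Comments (b), (d)] [cite: Moh1987, Stability Theorem (p. 966)] -/
theorem ledger_lt_of_edge_of_riseD_of_shade_constant {S : Finset (Fin 4)} (s s' : State K)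
    (h1 : IsPermissibleCentre p S s.F) (h2 : Perm2 S s) (hclean : deletePthPowers p s.F = s.F)
    (hF : s.F ≠ 0) (hr : ∀ d ∈ s.F.support, s.r ≤ d) (hexc : ∀ i, s.r i ≠ 0 → i ∈ s.exc)
    (hconst : ∀ c : Fin 4 → K, (∀ i ∈ S, c i = 0) →
      CState.shade ⟨deletePthPowers p (PointBlowup.translate c s.F),
        s.r.filter (fun i => c i = 0), s.exc.filter (fun i => c i = 0)⟩ = s.shade)
    (hedge : Edge p S s s') (hrise : RiseD s s') :
    5 * s'.shade + 2 * ((s'.exc.filter fun i => ¬ p ∣ s'.r i).card : ℕ∞) + 2 * (s'.exc.card : ℕ∞) <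
      5 * s.shade + 2 * ((s.exc.filter fun i => ¬ p ∣ s.r i).card : ℕ∞) + 2 * (s.exc.card : ℕ∞) := by
  obtain ⟨j, b, hj, hbj, -, -, rfl⟩ := hedge
  have hc0 : ∀ i ∈ S, S.piecewise (0 : Fin 4 → K) b i = 0 := fun i hi => by
    rw [Finset.piecewise, if_pos hi, Pi.zero_apply]
  exact ledger_lt_of_riseD_piecewise p hj b hbj s hclean hF h1 h2 hr hexc (hconst _ hc0) hrise

end Frame

end Summit.ResolutionOfSingularities.ResolutionOfSingularities.Theorems.PIDim4.JumpLedger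

end
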